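/-
# Solo-blind programme on Kontsevich–Zagier, s6 part T3c: the Landen chart

The **negative dilogarithm cell** `D⁻(w) = [0 < s < t < w, ds dt/(t(1+s))]`, period
`∫₀ʷ log(1+t) dt/t = −Li₂(−w)`, for a real algebraic `w > 0`, and **Landen's move**: the Möbius
product chart

  `Φ(t, s) = (t/(1+t), s/(1+s))`

— a `ℚ`-rational, hence `ℚ`-semialgebraic, map — carries `D⁻(w)` onto the dilogarithm triangle
`{0 < q₁ < q₀ < u}`, `u = w/(1+w)`, of the cut `Cut.ofPos w`, with the pulled-back form
`dq/(q₀(1−q₀)(1−q₁))` (`dilogNeg_equiv_landenRep`, one move of rule (2)).  Splitting the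
integrand, `1/(q₀(1−q₀)(1−q₁)) = 1/(q₀(1−q₁)) + 1/((1−q₀)(1−q₁))` (rule (1b)), gives

  `[D⁻(w)] = [D(u)] + [C(u)]`,   `C(u) = [0 < q₁ < q₀ < u, dq/((1−q₀)(1−q₁))]`

(`mkQ_dilogNeg`).  The symmetrisation `2[C(u)] = ℓ(1+w)²` and Landen's identity
`−Li₂(−w) = Li₂(w/(1+w)) + ½ log²(1+w)` as an identity of KZ classes follow in `SoloBlindLanden`.
-/
import Summits.KontsevichZagierPeriods.KontsevichZagierPeriods.Theorems.SoloBlindDilogEuler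

noncomputable section

open MeasureTheory Set MvPolynomial
open Literature.NumberTheory.Transcendental
open Literature.NumberTheory.Transcendental.KZ
open Literature.NumberTheory.Transcendental.KZ.IntegralRep
open Literature.ModelTheory.ExponentialFields (IsSemialgebraic isSemialgebraic_setOf_eval_pos)

namespace Summit.KontsevichZagierPeriods.KontsevichZagierPeriods.Theorems

namespace SoloBlind

/-! ## The Möbius coordinate `r ↦ r/(1+r)` -/

/-- `r/(1+r) = 1 − 1/(1+r)`. -/
theorem landenCoord_eq {r : ℝ} (hr : 1 + r ≠ 0) : r * (1 + r)⁻¹ = 1 - (1 + r)⁻¹ := by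
  field_simp
  ring

/-- `r ↦ r/(1+r)` is strictly increasing on `(−1, ∞)`. -/
theorem landenCoord_lt {r s : ℝ} (hr : -1 < r) (hrs : r < s) :
    r * (1 + r)⁻¹ < s * (1 + s)⁻¹ := by
  rw [landenCoord_eq (by linarith), landenCoord_eq (by linarith)]
  have := (inv_lt_inv₀ (by linarith : (0 : ℝ) < 1 + s) (by linarith : (0 : ℝ) < 1 + r)).2
    (by linarith)
  linarith

/-- The derivative of `r ↦ r/(1+r)` is `1/(1+r)²`. -/
theorem hasDerivAt_landenCoord {r : ℝ} (hr : 1 + r ≠ 0) :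
    HasDerivAt (fun r : ℝ => r * (1 + r)⁻¹) ((1 + r) ^ 2)⁻¹ r := by
  have h1 : HasDerivAt (fun r : ℝ => 1 + r) 1 r := by
    simpa using (hasDerivAt_id r).const_add 1
  have h2 : HasDerivAt (fun y : ℝ => y * (1 + y)⁻¹) (1 * (1 + r)⁻¹ + r * (-1 / (1 + r) ^ 2)) r :=
    (hasDerivAt_id' r).mul (h1.inv hr)
  refine h2.congr_deriv ?_
  field_simp
  ring

/-- The inverse Möbius coordinate: `Φ(q/(1−q)) = q`. -/
theorem landenCoord_inv {q : ℝ} (hq : q ≠ 1) :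
    q * (1 - q)⁻¹ * (1 + q * (1 - q)⁻¹)⁻¹ = q := by
  have h : 1 - q ≠ 0 := sub_ne_zero.2 (Ne.symm hq)
  have h' : 1 + q * (1 - q)⁻¹ = (1 - q)⁻¹ := by field_simp; ring
  rw [h', mul_assoc, mul_inv_cancel₀ (inv_ne_zero h), mul_one]

/-- `q ↦ q/(1−q)` is strictly increasing on `(−∞, 1)`. -/
theorem invLandenCoord_lt {q q' : ℝ} (hq' : q' < 1) (h : q < q') :
    q * (1 - q)⁻¹ < q' * (1 - q')⁻¹ := by
  have e : ∀ x : ℝ, x ≠ 1 → x * (1 - x)⁻¹ = (1 - x)⁻¹ - 1 := fun x hx => by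
    have : 1 - x ≠ 0 := sub_ne_zero.2 (Ne.symm hx)
    field_simp
    ring
  rw [e q (by linarith), e q' hq'.ne]
  have := (inv_lt_inv₀ (by linarith : (0 : ℝ) < 1 - q) (by linarith : (0 : ℝ) < 1 - q')).2
    (by linarith)
  linarith

/-! ## The negative dilogarithm cell -/

section neg

variable {w : ℝ} (hw : IsAlgebraic ℚ w) (h0 : 0 < w)

/-- The cut `u = w/(1+w)` attached to `w > 0`. -/
def Cut.ofPos : Cut :=
  ⟨w * (1 + w)⁻¹, hw.mul (isAlgebraic_one.add hw).inv, mul_pos h0 (inv_pos.2 (by linarith)), by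
    rw [landenCoord_eq (by linarith)]
    have := inv_pos.2 (by linarith : (0 : ℝ) < 1 + w)
    linarith⟩

/-- Its cut point. -/
@[simp] theorem Cut.ofPos_x : (Cut.ofPos hw h0).x = w * (1 + w)⁻¹ := rfl

/-- `1/(1−u) = 1 + w`. -/
theorem Cut.inv_one_sub_ofPos_x : (1 - (Cut.ofPos hw h0).x)⁻¹ = 1 + w := by
  rw [Cut.ofPos_x, landenCoord_eq (by linarith), sub_sub_cancel, inv_inv]

/-- The triangle `{0 < p₁ < p₀ < w}` of `D⁻(w)`. -/
def negDom (w : ℝ) : Set (Fin 2 → ℝ) := {p | 0 < p 1 ∧ p 1 < p 0 ∧ p 0 < w}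

include hw in
/-- It is semialgebraic (`w` algebraic). -/
theorem isSemialgebraic_negDom : IsSemialgebraic ℚ (negDom w) := by
  convert isSemialgebraic_sep_apply_lt isSemialgebraic_wedge 0 hw using 1
  ext p; simp [negDom, and_assoc]

/-- The form `1/(p₀(1+p₁))` of `D⁻`. -/
def negFun (p : Fin 2 → ℝ) : ℝ := 1 / (p 0 * (1 + p 1))

/-! ## The Landen chart -/

/-- The Möbius product chart `Φ(p) = (p₀/(1+p₀), p₁/(1+p₁))`. -/
def landenChart (p : Fin 2 → ℝ) : Fin 2 → ℝ := ![p 0 * (1 + p 0)⁻¹, p 1 * (1 + p 1)⁻¹]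

/-- `DΦ(p) = diag(1/(1+p₀)², 1/(1+p₁)²)`. -/
def landenDeriv (p : Fin 2 → ℝ) : (Fin 2 → ℝ) →L[ℝ] (Fin 2 → ℝ) :=
  ContinuousLinearMap.pi ![((1 + p 0) ^ 2)⁻¹ • pr2 0, ((1 + p 1) ^ 2)⁻¹ • pr2 1]

/-- `Φ` is differentiable off `{1 + pᵢ = 0}`. -/
theorem hasFDerivAt_landenChart {p : Fin 2 → ℝ} (hp : ∀ i, 1 + p i ≠ 0) :
    HasFDerivAt landenChart (landenDeriv p) p := by
  rw [hasFDerivAt_pi']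
  intro i
  have hrow : (pr2 i).comp (landenDeriv p) = ((1 + p i) ^ 2)⁻¹ • pr2 i :=
    ContinuousLinearMap.ext fun v => by fin_cases i <;> simp [landenDeriv]
  have hfun : (fun q : Fin 2 → ℝ => landenChart q i) = fun q => q i * (1 + q i)⁻¹ := by
    funext q; fin_cases i <;> simp [landenChart]
  rw [hrow, hfun]
  have hπ : HasFDerivAt (fun q : Fin 2 → ℝ => q i) (pr2 i) p := hasFDerivAt_apply i p
  have h := (hasDerivAt_landenCoord (hp i)).hasFDerivAt.comp p hπ
  refine h.congr_fderiv (ContinuousLinearMap.ext fun v => ?_)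
  simp [mul_comm]

/-- The matrix of `DΦ(p)`. -/
theorem toMatrix_landenDeriv (p : Fin 2 → ℝ) :
    LinearMap.toMatrix' ((landenDeriv p : (Fin 2 → ℝ) →L[ℝ] (Fin 2 → ℝ)) :
      (Fin 2 → ℝ) →ₗ[ℝ] (Fin 2 → ℝ)) = !![((1 + p 0) ^ 2)⁻¹, 0; 0, ((1 + p 1) ^ 2)⁻¹] := by
  ext i j
  rw [LinearMap.toMatrix'_apply, ContinuousLinearMap.coe_coe]
  fin_cases i <;> fin_cases j <;> simp [landenDeriv]

/-- `|det DΦ(p)| = 1/((1+p₀)²(1+p₁)²)`. -/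
theorem abs_det_landenDeriv {p : Fin 2 → ℝ} (hp : ∀ i, 1 + p i ≠ 0) :
    |(landenDeriv p).det| = ((1 + p 0) ^ 2)⁻¹ * ((1 + p 1) ^ 2)⁻¹ := by
  rw [ContinuousLinearMap.det, ← LinearMap.det_toMatrix', toMatrix_landenDeriv,
    Matrix.det_fin_two_of]
  simp only [mul_zero, sub_zero]
  exact abs_of_pos (mul_pos (inv_pos.2 (sq_pos_iff.2 (hp 0))) (inv_pos.2 (sq_pos_iff.2 (hp 1))))

/-- On `D⁻(w)` the denominators `1 + pᵢ` are positive. -/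
theorem one_add_pos_of_mem_negDom {p : Fin 2 → ℝ} (hp : p ∈ negDom w) (i : Fin 2) :
    0 < 1 + p i := by
  obtain ⟨h1, h2, _⟩ := hp
  fin_cases i
  · show 0 < 1 + p 0
    linarith
  · show 0 < 1 + p 1
    linarith

/-- `Φ` is injective on `D⁻(w)`. -/
theorem injOn_landenChart : InjOn landenChart (negDom w) := by
  intro p hp p' hp' h
  have h0 := congrFun h 0
  have h1 := congrFun h 1
  simp only [landenChart, Matrix.cons_val_zero, Matrix.cons_val_one] at h0 h1
  rw [landenCoord_eq (one_add_pos_of_mem_negDom hp 0).ne',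
    landenCoord_eq (one_add_pos_of_mem_negDom hp' 0).ne'] at h0
  rw [landenCoord_eq (one_add_pos_of_mem_negDom hp 1).ne',
    landenCoord_eq (one_add_pos_of_mem_negDom hp' 1).ne'] at h1
  have e0 := inv_injective (sub_right_injective h0)
  have e1 := inv_injective (sub_right_injective h1)
  funext i
  fin_cases i
  · show p 0 = p' 0
    linarith
  · show p 1 = p' 1
    linarith

/-- `Φ(D⁻(w)) = D(u)`, `u = w/(1+w)`. -/
theorem image_landenChart : landenChart '' negDom w = cutDom (Cut.ofPos hw h0) := by
  ext q
  simp only [mem_image, negDom, cutDom, Cut.ofPos_x, mem_setOf_eq]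
  constructor
  · rintro ⟨p, ⟨h1, h2, h3⟩, rfl⟩
    simp only [landenChart, Matrix.cons_val_zero, Matrix.cons_val_one]
    exact ⟨mul_pos h1 (inv_pos.2 (by linarith)), landenCoord_lt (by linarith) h2,
      landenCoord_lt (by linarith) h3⟩
  · rintro ⟨h1, h2, h3⟩
    have hu : w * (1 + w)⁻¹ < 1 := (Cut.ofPos hw h0).lt_one
    have hq0 : q 0 < 1 := h3.trans hu
    have hq1 : q 1 < 1 := h2.trans hq0
    refine ⟨![q 0 * (1 - q 0)⁻¹, q 1 * (1 - q 1)⁻¹], ⟨?_, ?_, ?_⟩, ?_⟩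
    · show 0 < q 1 * (1 - q 1)⁻¹
      exact mul_pos h1 (inv_pos.2 (by linarith))
    · show q 1 * (1 - q 1)⁻¹ < q 0 * (1 - q 0)⁻¹
      exact invLandenCoord_lt hq0 h2
    · show q 0 * (1 - q 0)⁻¹ < w
      have h := invLandenCoord_lt hu h3
      rwa [landenCoord_eq (by linarith : (1 : ℝ) + w ≠ 0), sub_sub_cancel, inv_inv,
        show (1 - (1 + w)⁻¹) * (1 + w) = w by field_simp; ring] at h
    · funext i
      fin_cases i
      · show q 0 * (1 - q 0)⁻¹ * (1 + q 0 * (1 - q 0)⁻¹)⁻¹ = q 0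
        exact landenCoord_inv hq0.ne
      · show q 1 * (1 - q 1)⁻¹ * (1 + q 1 * (1 - q 1)⁻¹)⁻¹ = q 1
        exact landenCoord_inv hq1.ne

include hw in
/-- `Φ` is a `ℚ`-rational, hence `ℚ`-semialgebraic, map on `D⁻(w)`. -/
theorem isSemialgebraicMapOn_landenChart : IsSemialgebraicMapOn ℚ (negDom w) landenChart := by
  have hS := isSemialgebraic_negDom hw
  refine IsSemialgebraicMapOn.of_forall hS fun i => ?_
  fin_cases i
  · exact (isSemialgebraicFunOn_aeval_div_aeval hS (X 0) (1 + X 0) fun p hp => by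
      simpa using (one_add_pos_of_mem_negDom hp 0).ne').congr fun p _ => by
        simp [landenChart, div_eq_mul_inv]
  · exact (isSemialgebraicFunOn_aeval_div_aeval hS (X 1) (1 + X 1) fun p hp => by
      simpa using (one_add_pos_of_mem_negDom hp 1).ne').congr fun p _ => by
        simp [landenChart, div_eq_mul_inv]

/-! ## The pulled-back form and the two dilogarithm-type cells on `D(u)` -/

/-- The Landen form `1/(q₀(1−q₀)(1−q₁))`. -/
def landenFun (q : Fin 2 → ℝ) : ℝ := 1 / (q 0 * (1 - q 0) * (1 - q 1))

/-- The co-dilogarithm form `1/((1−q₀)(1−q₁))`. -/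
def coFun (q : Fin 2 → ℝ) : ℝ := 1 / ((1 - q 0) * (1 - q 1))

/-- `negFun = (landenFun ∘ Φ)·|det DΦ|` on `D⁻(w)`. -/
theorem negFun_eq {p : Fin 2 → ℝ} (hp : p ∈ negDom w) :
    negFun p = landenFun (landenChart p) * (((1 + p 0) ^ 2)⁻¹ * ((1 + p 1) ^ 2)⁻¹) := by
  have a0 := (one_add_pos_of_mem_negDom hp 0).ne'
  have a1 := (one_add_pos_of_mem_negDom hp 1).ne'
  have b0 : p 0 ≠ 0 := by have := hp.1; have := hp.2.1; linarith
  simp only [negFun, landenFun, landenChart, Matrix.cons_val_zero, Matrix.cons_val_one]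
  rw [landenCoord_eq a0, landenCoord_eq a1, sub_sub_cancel, sub_sub_cancel, ← landenCoord_eq a0]
  field_simp

/-- `landenFun = dilogFun + coFun` where the denominators do not vanish. -/
theorem landenFun_eq_add {q : Fin 2 → ℝ} (h0 : q 0 ≠ 0) (h1 : 1 - q 0 ≠ 0) (h2 : 1 - q 1 ≠ 0) :
    landenFun q = dilogFun q + coFun q := by
  simp only [landenFun, dilogFun, coFun]
  field_simp
  ring

variable (c : Cut)

/-- On `D(u)` the denominators do not vanish. -/
theorem den_ne_zero_of_mem_cutDom {q : Fin 2 → ℝ} (hq : q ∈ cutDom c) :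
    q 0 ≠ 0 ∧ 1 - q 0 ≠ 0 ∧ 1 - q 1 ≠ 0 := by
  obtain ⟨h1, h2, h3⟩ := hq
  have := c.lt_one
  exact ⟨by linarith, by linarith, by linarith⟩

/-- `coFun` is integrable on `D(u)` (continuous on the closed box `[0,u]²`). -/
theorem integrableOn_coFun : IntegrableOn coFun (cutDom c) := by
  have hu := c.lt_one
  have hK : IntegrableOn coFun (Icc ![0, 0] ![c.x, c.x]) := by
    refine ContinuousOn.integrableOn_compact isCompact_Icc ?_
    refine continuousOn_const.div (by fun_prop) fun q hq => ?_
    have a0 : q 0 ≤ c.x := by simpa using hq.2 0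
    have a1 : q 1 ≤ c.x := by simpa using hq.2 1
    exact mul_ne_zero (by linarith) (by linarith)
  refine hK.mono_set fun q hq => ⟨fun i => ?_, fun i => ?_⟩
  · fin_cases i
    · simpa using (hq.1.trans hq.2.1).le
    · simpa using hq.1.le
  · fin_cases i
    · simpa using hq.2.2.le
    · simpa using (hq.2.1.trans hq.2.2).le

/-- **The co-dilogarithm cell** `C(u) = [0 < q₁ < q₀ < u, dq/((1−q₀)(1−q₁))]`. -/
def coRep : IntegralRep 2 :=
  ratRep (cutDom c) coFun 1 ((1 - X 0) * (1 - X 1)) (isSemialgebraic_cutDom c)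
    (fun q hq => by
      obtain ⟨_, h1, h2⟩ := den_ne_zero_of_mem_cutDom c hq
      simpa using mul_ne_zero h1 h2)
    (fun q _ => by simp [coFun]) (integrableOn_coFun c)

/-- **The Landen cell** `[0 < q₁ < q₀ < u, dq/(q₀(1−q₀)(1−q₁))]`. -/
def landenRep : IntegralRep 2 :=
  ratRep (cutDom c) landenFun 1 (X 0 * (1 - X 0) * (1 - X 1)) (isSemialgebraic_cutDom c)
    (fun q hq => by
      obtain ⟨h0, h1, h2⟩ := den_ne_zero_of_mem_cutDom c hq
      simpa using mul_ne_zero (mul_ne_zero h0 h1) h2)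
    (fun q _ => by simp [landenFun])
    ((((dilogCut c).integrableOn.add (integrableOn_coFun c)).congr_fun (fun q hq => by
        obtain ⟨h0, h1, h2⟩ := den_ne_zero_of_mem_cutDom c hq
        exact (landenFun_eq_add h0 h1 h2).symm)
      (IsSemialgebraic.measurableSet_holds (isSemialgebraic_cutDom c))))

/-- **Integrand move (rule (1b)).** `[Landen cell] − [D(u)] − [C(u)]` is a relation. -/
theorem landenRep_split : of (landenRep c) - of (dilogCut c) - of (coRep c) ∈ relations :=
  integrandAddRel_subset_relations ⟨2, landenRep c, dilogCut c, coRep c, rfl, rfl,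
    fun q hq => by
      obtain ⟨h0, h1, h2⟩ := den_ne_zero_of_mem_cutDom c hq
      exact landenFun_eq_add h0 h1 h2, rfl⟩

/-! ## `D⁻(w)` and the Landen move -/

/-- **The negative dilogarithm cell** `D⁻(w) = [0 < p₁ < p₀ < w, dp/(p₀(1+p₁))]`, period
`−Li₂(−w)`; convergence is transported from the Landen cell along `Φ`. -/
def dilogNeg : IntegralRep 2 :=
  ratRep (negDom w) negFun 1 (X 0 * (1 + X 1)) (isSemialgebraic_negDom hw)
    (fun p hp => by
      have := hp.1; have := hp.2.1
      simpa using mul_ne_zero (by linarith : p 0 ≠ 0) (one_add_pos_of_mem_negDom hp 1).ne')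
    (fun p _ => by simp [negFun])
    ((integrableOn_iff_of_chart (IsSemialgebraic.measurableSet_holds (isSemialgebraic_negDom hw))
        (fun _ hp => hasFDerivAt_landenChart fun i => (one_add_pos_of_mem_negDom hp i).ne')
        injOn_landenChart (J := fun p => ((1 + p 0) ^ 2)⁻¹ * ((1 + p 1) ^ 2)⁻¹) (f := negFun)
        (g := landenFun)
        (fun _ hp => abs_det_landenDeriv fun i => (one_add_pos_of_mem_negDom hp i).ne')
        (fun _ hp => negFun_eq hp)).mp
      (by rw [image_landenChart hw h0]; exact (landenRep _).integrableOn))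

/-- `D⁻(w)` is a rational representation. -/
theorem dilogNeg_isRational : (dilogNeg hw h0).IsRational := isRational_ratRep ..

/-- **The Landen move (rule (2)).** `D⁻(w) ≡` the Landen cell of `u = w/(1+w)`. -/
theorem dilogNeg_equiv_landenRep : Equivalent (dilogNeg hw h0) (landenRep (Cut.ofPos hw h0)) :=
  equivalent_of_chart (isSemialgebraicMapOn_landenChart hw)
    (fun _ hp => hasFDerivAt_landenChart fun i => (one_add_pos_of_mem_negDom hp i).ne')
    injOn_landenChart (image_landenChart hw h0)
    (J := fun p => ((1 + p 0) ^ 2)⁻¹ * ((1 + p 1) ^ 2)⁻¹)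
    (fun _ hp => abs_det_landenDeriv fun i => (one_add_pos_of_mem_negDom hp i).ne')
    (fun _ hp => negFun_eq hp) rfl (fun _ _ => rfl) rfl (fun _ _ => rfl)

/-- **`[D⁻(w)] = [D(u)] + [C(u)]`** in `Q`, `u = w/(1+w)`. -/
theorem mkQ_dilogNeg : mkQ (of (dilogNeg hw h0)) =
    mkQ (of (dilogCut (Cut.ofPos hw h0))) + mkQ (of (coRep (Cut.ofPos hw h0))) := by
  rw [← map_add, mkQ_eq_mkQ_iff]
  have e : of (dilogNeg hw h0) - (of (dilogCut (Cut.ofPos hw h0)) + of (coRep (Cut.ofPos hw h0))) =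
      (of (dilogNeg hw h0) - of (landenRep (Cut.ofPos hw h0))) +
        (of (landenRep (Cut.ofPos hw h0)) - of (dilogCut (Cut.ofPos hw h0)) -
          of (coRep (Cut.ofPos hw h0))) := by abel
  rw [e]
  exact add_mem (dilogNeg_equiv_landenRep hw h0) (landenRep_split _)

end neg

end SoloBlind

end Summit.KontsevichZagierPeriods.KontsevichZagierPeriods.Theorems
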